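import Summits.Ventures.GridStability.Lyapunov.NE39LossySplitLinesU23o1600RecDualTests
import Summits.Ventures.GridStability.Lyapunov.NE39LossySplitLinesU3o200LPCert
import Literature.MathematicalPhysics.PowerSystems.LuriePostnikovSlabDualWitness
import Summits.Ventures.GridStability.Lyapunov.NE39LossySplitLinesU7o500SlabCert
import Summits.Ventures.GridStability.Lyapunov.NE39LossySplitLinesLPDual
import HarnessLib

/-!
# «NE39-LOSSY-SPLITU-RECORD-CEILING-TIGHT» — the CLASS OF RECORD on the UNORDERED-LINES split presentation of the lossy 39-bus
# 10-machine Kron model is EMPTY from `2·arctan(23/1600)` (≈ 1.647°) on — a RANK-19 GRAM-FACTORED dual witness — and THE TIGHTENED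
# RECORD BRACKET [2·arctan(7/500), 2·arctan(23/1600)] ≈ [1.604°, 1.647°] (with `NE39LossySplitLinesU7o500SlabCert`)

**OBSTRUCTION file, class of record only; seat gridfusion-lit-6 (g11).**  THIS FILE = lit-6 g10's record-ceiling chain
`NE39LossySplitLinesRecDual` (p602957, window `2·arctan(3/200)`, ★ #203) RE-INSTANTIATED one bisection step DOWN, at the SMALLEST window
whose class-of-record Gram dual rounds exactly in the seat's scan, `γ₀ = 2·arctan(23/1600)` ≈ 1.647° (names carry the chain suffix `ᵣ₂`).
For `S = NE39.splitLurieLinesSystem` (MODEL M = `NE39.preLossless.toModelRel (1/10) 0`; Pai's split presentation (3.43),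
`Models/NE39SplitLurieLines.lean`):

* `D : SlabDualWitness NE39.splitLurieLinesSystem a0 b0` — the CLASS-OF-RECORD dual witness (`Z ⪰ 0`, (D1) EXACT, (D2), (D3) `s_k ≥ 0` where
  `a0_k ≥ 0`, (D4)), shipped as its rank-19 GRAM FACTOR `Z := [G1; H]·[G1; H]ᵀ` (data file A), positive semidefinite by
  `Matrix.posSemidef_self_mul_conjTranspose` (`psd`); `C·B = 0` ⇒ no functional reads `Z₂₂` off its diagonal (`Z₂₂ := H·Hᵀ`); the blocks the
  functionals read are the kernel-decided tables (`Z11Q_gramᵣ₂`, `Z21Q_gramᵣ₂`);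
* `no_splitSlabCertificate_at₂` — **no** `Λ : SlabCertificate S` (`P ⪰ ε·1`, Popov terms only on channels with `a ≥ 0`) satisfies the
  sector hypothesis of lit-6's slab ROA theorem for the window `2·arctan(23/1600)` (stated with the EXPLICIT window; the `γ₀` form is the private
  `no_splitSlabCertificate_γ₀` — its text would coincide with the ᵣ chain's); `no_splitSlabCertificate_perChannel` (per-channel windows `≥ γ₀`
  on the 180 channels `p ≠ q`); `recordClass_empty_from_NE39` (the set form, every window `≥ 2·arctan(23/1600)`);
* `γ₀_eq`, `γ₀_le`, `cos_sin_γ₀`, `recordBracket_ends_lt` — the window in closed form and its position `2·arctan(7/500) < γ₀ < 2·arctan(3/200)`;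
* **`splitBrackets_tighter_NE39`** — with `NE39LossySplitLinesU7o500SlabCert.slabSplitClass_nonempty_NE39` (record NON-EMPTY at `2·arctan(7/500)`),
  `NE39LossySplitLinesU3o200LPCert.lpSplitClass_nonempty_NE39` (positivity NON-EMPTY at `2·arctan(3/200)`) and
  `NE39LossySplitLinesLPDual.lpSplitClass_empty_NE39` (positivity EMPTY from `2·arctan(13/800)`): the supremum of record-certifiable windows
  lies in [1.604°, 1.647°], that of the positivity class in [1.719°, 1.862°] (closed brackets, read as typed; ★ #210's were
  [1.146°, 1.719°] / [1.719°, 1.862°]).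

Producer (not trusted; every acceptance inequality is re-decided over `ℚ` in the kernel, files `…RecDualKernel` /
`…RecDualTests`): lit-6 g11 kit j300210 (`probes/splitgen/splitu_generic.py` JOB_SYSTEM=NE39 JOB_MODE=dualgram JOB_ACT=pairs JOB_CLASSES=old, class `old` (the class of record);
output `splitu_NE39_dualgram_lam1o10_pairs.json` sha16 `ee20730606d8ffae`, results[u0 = 23/1600, klass = old]): max-margin CLASS-OF-RECORD dual SDP in floats (CLARABEL,
`N = 19 + 180`, margin `μ* ≈ 4.79e-10`), then the GRAM FACTORISATION `G1 = chol(Z₁₁)` (19 × 19 lower), `H = Z₂₁·G1⁻ᵀ` (180 × 19),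
dyadic rounding `2^-28`, and `Z := [G1; H]·[G1; H]ᵀ` EXACTLY — rank 19, positive semidefinite BY CONSTRUCTION (no 219 × 219
decision anywhere); since `C·B = 0` no dual functional reads `Z₂₂` off its diagonal, and the diagonal `|H_k|²` is the smallest
admissible one.  Exact re-check (`gen_ne39_recdual_v2.py`): `W + Wᵀ` min pivot `1.45e-07`, min (D2) `1.74e-11`, min (D3) `s_k` (a0 ≥ 0)
`1.20e-08`, `tr Z₁₁ = 1`.
THREE COLUMNS.  CERTIFIED: «no certificate of the class of record (`SlabCertificate S` + `hsec`) certifies a slab half-width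
`≥ 2·arctan(23/1600)` (≈ 1.647°) on MODEL M; with the three named files, the record-class supremum lies in [1.604°, 1.647°] and the
positivity-class supremum in [1.719°, 1.862°]» — statements about CERTIFICATE CLASSES on one model, not about any region of attraction.
VALIDATED (floats, CLARABEL; lit-6 g11 kit j300045 / j300140 / j300200 primal, j300210 dual; jsons `probes/rectight/`): class-of-record primal
margin `ν* > 0` at `u = 9/800, 1/80, 11/800, 7/500` and `< 0` at `57/4000` (1.633°), `229/16000`, `23/1600`, `47/3200`, `59/4000`; exact
record Gram duals rounded at `23/1600` (den `2^28`, this file) and `47/3200` (den `2^24`, untyped); by floats the record supremum lies in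
(1.604°, 1.633°).  MODELLED: as «NE39-LOSSY-SPLITU» / model-4's record (uniform damping `λ = 1/10` ASSUMED).  Nothing here says the
39-bus system or any grid is stable or unstable.
[cite: BoydVandenberghe2004, §5.9.4 (5.97)–(5.98), Example 5.14; Khalil2002, §7.1 Example 7.5, §7.1.2 Theorem 7.3; Pai1981, §3.6.3 (3.43)–(3.45), §4.6 p. 117; HornJohnson2013, Thm 7.2.7]
-/

noncomputable section

open Real Matrix
open Literature.Computation.Certificates
open Literature.MathematicalPhysics.PowerSystems
open Literature.MathematicalPhysics.PowerSystems.LyapunovFunctionFamily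
open Summit.Ventures.GridStability.Models
open Summit.Ventures.GridStability.Lyapunov.NE39LossySplitLines (e1 AQ CQ BLQ A_eq C_eq B_eq C_mul_B)

namespace Summit.Ventures.GridStability.Lyapunov.NE39LossySplitLinesU23o1600RecDual

/-! ### Cast plumbing (the parent files' copies are private) -/

/-- `(M + N) ↦ ℝ` (cast plumbing). -/ private theorem map_add' {m n : Type*} (M N : Matrix m n ℚ) :
    (M + N).map (Rat.cast : ℚ → ℝ) = M.map (Rat.cast : ℚ → ℝ) + N.map (Rat.cast : ℚ → ℝ) := by
  ext i k; simp
/-- `(M − N) ↦ ℝ` (cast plumbing). -/ private theorem map_sub' {m n : Type*} (M N : Matrix m n ℚ) :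
    (M - N).map (Rat.cast : ℚ → ℝ) = M.map (Rat.cast : ℚ → ℝ) - N.map (Rat.cast : ℚ → ℝ) := by
  ext i k; simp
/-- `(q • M) ↦ ℝ` (cast plumbing). -/ private theorem map_smul' {m n : Type*} (q : ℚ) (M : Matrix m n ℚ) :
    (q • M).map (Rat.cast : ℚ → ℝ) = ((q : ℚ) : ℝ) • M.map (Rat.cast : ℚ → ℝ) := by
  ext i k; simp
/-- `(M N) ↦ ℝ` (cast plumbing). -/ private theorem map_mul' {l m n : Type*} [Fintype m] (M : Matrix l m ℚ) (N : Matrix m n ℚ) :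
    (M * N).map (Rat.cast : ℚ → ℝ) = M.map (Rat.cast : ℚ → ℝ) * N.map (Rat.cast : ℚ → ℝ) := by
  ext i k; simp [Matrix.mul_apply]
/-- `Mᵀ ↦ ℝ` (cast plumbing). -/ private theorem map_transpose' {m n : Type*} (M : Matrix m n ℚ) :
    Mᵀ.map (Rat.cast : ℚ → ℝ) = (M.map (Rat.cast : ℚ → ℝ))ᵀ := by
  ext i k; simp

/-! ### The witness data over `ℝ` -/

/-- `Z₁₁ ↦ ℝ`. -/
def Z₁₁ : Matrix (Fin 10 ⊕ Fin 9) (Fin 10 ⊕ Fin 9) ℝ := Z11Qᵣ₂.map (Rat.cast : ℚ → ℝ)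
/-- `Z₂₁ ↦ ℝ`. -/
def Z₂₁ : Matrix ((Fin 10 × Fin 10) ⊕ (Fin 10 × Fin 10)) (Fin 10 ⊕ Fin 9) ℝ := Z21Qᵣ₂.map (Rat.cast : ℚ → ℝ)
/-- `Z₂₂ = H·Hᵀ ↦ ℝ`. -/
def Z₂₂ : Matrix ((Fin 10 × Fin 10) ⊕ (Fin 10 × Fin 10)) ((Fin 10 × Fin 10) ⊕ (Fin 10 × Fin 10)) ℝ := Z22Qᵣ₂.map (Rat.cast : ℚ → ℝ)
/-- The factor's state block over `ℝ`. -/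
def G1r : Matrix (Fin 10 ⊕ Fin 9) (Fin 19) ℝ := G1Tᵣ₂.map (Rat.cast : ℚ → ℝ)
/-- The factor's channel block over `ℝ`. -/
def Hr : Matrix ((Fin 10 × Fin 10) ⊕ (Fin 10 × Fin 10)) (Fin 19) ℝ := HTᵣ₂.map (Rat.cast : ℚ → ℝ)
/-- The witness's lower slopes over `ℝ`. -/
def a0 (k : (Fin 10 × Fin 10) ⊕ (Fin 10 × Fin 10)) : ℝ := (a0Kᵣ₂ k : ℝ)
/-- The witness's upper slopes over `ℝ`. -/
def b0 (k : (Fin 10 × Fin 10) ⊕ (Fin 10 × Fin 10)) : ℝ := (b0Kᵣ₂ k : ℝ)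
/-- The window `γ₀ = 2·arctan(23/1600)` (≈ 1.647°). -/
def γ₀ : ℝ := 2 * Real.arctan ((u0Qᵣ₂ : ℚ) : ℝ)

/-- `γ₀` is the literal window `2·arctan(23/1600)` of the row's name. -/
theorem γ₀_eq : γ₀ = 2 * Real.arctan (23 / 1600 : ℝ) := by
  unfold γ₀; norm_num [u0Qᵣ₂]

/-- `cos γ₀ = cg0Qᵣ₂` (cast form, feeds `hwin`). -/
private theorem cos_γ₀_cast : Real.cos γ₀ = ((cg0Qᵣ₂ : ℚ) : ℝ) := by
  unfold γ₀ cg0Qᵣ₂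
  rw [Lyapunov.StructurePreserving.cos_two_mul_arctan]
  push_cast
  ring

/-- `sin γ₀ = sg0Qᵣ₂` (cast form, feeds `hwin`). -/
private theorem sin_γ₀_cast : Real.sin γ₀ = ((sg0Qᵣ₂ : ℚ) : ℝ) := by
  unfold γ₀ sg0Qᵣ₂
  rw [Lyapunov.StructurePreserving.sin_two_mul_arctan]
  push_cast
  ring

/-- **`cos(2·arctan(23/1600)) = 2559471/2560529`**, **`sin = 73600/2560529`** (closed forms). -/
theorem cos_sin_γ₀ : Real.cos (2 * Real.arctan (23 / 1600 : ℝ)) = 2559471 / 2560529 ∧ Real.sin (2 * Real.arctan (23 / 1600 : ℝ)) = 73600 / 2560529 := by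
  rw [← γ₀_eq, cos_γ₀_cast, sin_γ₀_cast]; constructor <;> norm_num [cg0Qᵣ₂, sg0Qᵣ₂, u0Qᵣ₂]

/-- `0 ≤ γ₀ < π/2`. -/
private theorem γ₀_range : 0 ≤ γ₀ ∧ γ₀ < π / 2 := by
  have hu : (0 : ℝ) ≤ ((u0Qᵣ₂ : ℚ) : ℝ) := by exact_mod_cast u0Q_pos_ltᵣ₂.1.le
  have hu1 : ((u0Qᵣ₂ : ℚ) : ℝ) < 1 := by exact_mod_cast u0Q_pos_ltᵣ₂.2
  exact ⟨Lyapunov.StructurePreserving.two_mul_arctan_nonneg hu,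
    Lyapunov.StructurePreserving.two_mul_arctan_lt_pi_div_two hu1⟩

/-- `γ₀ ≤ 23 / 800` rad (`arctan u ≤ u`). -/
theorem γ₀_le : γ₀ ≤ 23 / 800 := by
  unfold γ₀
  have h : Real.arctan ((u0Qᵣ₂ : ℚ) : ℝ) ≤ ((u0Qᵣ₂ : ℚ) : ℝ) :=
    Lyapunov.StructurePreserving.arctan_le_self (by exact_mod_cast u0Q_pos_ltᵣ₂.1.le)
  have : ((u0Qᵣ₂ : ℚ) : ℝ) = 23 / 1600 := by norm_num [u0Qᵣ₂]
  linarith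

/-! ### `Z ⪰ 0` BY THE GRAM STRUCTURE, and (D1) over `ℝ` -/

/-- The receptacle's block matrix IS `[G1; H]·[G1; H]ᵀ` (plumbing). -/
private theorem fromBlocks_eq_gram :
    Matrix.fromBlocks Z₁₁ Z₂₁ᵀ Z₂₁ Z₂₂ = Matrix.fromRows G1r Hr * (Matrix.fromRows G1r Hr)ᴴ := by
  rw [Matrix.conjTranspose_eq_transpose_of_trivial, Matrix.transpose_fromRows, Matrix.fromRows_mul_fromCols,
    Z₁₁, Z₂₁, Z₂₂, Z11Q_gramᵣ₂, Z21Q_gramᵣ₂, Z22Qᵣ₂, G1r, Hr, map_mul', map_mul', map_mul', map_transpose', map_transpose',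
    Matrix.transpose_mul, Matrix.transpose_transpose]

/-- **`Z ⪰ 0`** — for free: a Gram matrix (feeds `D`). [cite: HornJohnson2013, Thm 7.2.7] -/
private theorem psd : (Matrix.fromBlocks Z₁₁ Z₂₁ᵀ Z₂₁ Z₂₂).PosSemidef := by
  rw [fromBlocks_eq_gram]
  exact Matrix.posSemidef_self_mul_conjTranspose _

/-- **The adjoint image is rational**: `W + Wᵀ = HQᵣ₂ ↦ ℝ` (plumbing). -/
private theorem adj_eq : dualAdjP NE39.splitLurieLinesSystem Z₁₁ Z₂₁ + (dualAdjP NE39.splitLurieLinesSystem Z₁₁ Z₂₁)ᵀ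
    = HQᵣ₂.map (Rat.cast : ℚ → ℝ) := by
  have hX : dualAdjP NE39.splitLurieLinesSystem Z₁₁ Z₂₁ = XQᵣ₂.map (Rat.cast : ℚ → ℝ) := by
    rw [dualAdjP, A_eq, B_eq, Z₁₁, Z₂₁, XQᵣ₂, map_sub', map_add', map_mul', map_mul', map_transpose',
      map_smul', map_mul', Rat.cast_ofNat]
  rw [hX, HQᵣ₂, map_add', map_transpose']

/-- **(D1)** `W + Wᵀ ⪰ 0` (feeds `D`). -/
private theorem adjP_psd :
    (dualAdjP NE39.splitLurieLinesSystem Z₁₁ Z₂₁ + (dualAdjP NE39.splitLurieLinesSystem Z₁₁ Z₂₁)ᵀ).PosSemidef := by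
  rw [adj_eq, HQ_eqᵣ₂]
  exact (HD_ldlᵣ₂.posSemidef (R := ℝ)).submatrix e1

/-! ### (D2), (D3), (D4) and the null channels over `ℝ` -/

/-- The four dual functionals are the casts of `UQᵣ₂`, `VQᵣ₂`, `WQᵣ₂`, `SQᵣ₂` (`s_k` loses its `B`-part because `C·B = 0`). -/
theorem functionals_eq (k : (Fin 10 × Fin 10) ⊕ (Fin 10 × Fin 10)) :
    (NE39.splitLurieLinesSystem.C * Z₁₁ * NE39.splitLurieLinesSystem.Cᵀ) k k = ((UQᵣ₂ k : ℚ) : ℝ) ∧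
    (Z₂₁ * NE39.splitLurieLinesSystem.Cᵀ) k k = ((VQᵣ₂ k : ℚ) : ℝ) ∧
    Z₂₂ k k = ((WQᵣ₂ k : ℚ) : ℝ) ∧
    dualPopovCoeff NE39.splitLurieLinesSystem Z₂₁ Z₂₂ k = ((SQᵣ₂ k : ℚ) : ℝ) := by
  have hCB := C_mul_B
  refine ⟨?_, ?_, ?_, ?_⟩
  · rw [C_eq, Z₁₁, ← map_transpose', ← map_mul', ← map_mul', Matrix.map_apply, UQᵣ₂]
  · rw [C_eq, Z₂₁, ← map_transpose', ← map_mul', Matrix.map_apply, VQᵣ₂]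
  · rw [Z₂₂, Matrix.map_apply, WQᵣ₂]
  · rw [dualPopovCoeff, Matrix.mul_assoc, ← Matrix.mul_assoc NE39.splitLurieLinesSystem.C, hCB,
      Matrix.zero_mul, Matrix.zero_apply, sub_zero, C_eq, A_eq, Z₂₁, ← map_mul', ← map_transpose',
      ← map_mul', Matrix.map_apply, SQᵣ₂]

/-- **(D2)** at the witness slopes (feeds `D`). -/
private theorem sectorCoeff_nonneg (k : (Fin 10 × Fin 10) ⊕ (Fin 10 × Fin 10)) :
    0 ≤ dualSectorCoeff NE39.splitLurieLinesSystem Z₁₁ Z₂₁ Z₂₂ a0 b0 k := by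
  obtain ⟨hU, hV, hW, -⟩ := functionals_eq k
  rw [dualSectorCoeff, hU, hV, hW, a0, b0]
  exact_mod_cast (dual_testsᵣ₂ k).1

/-- **(D3)** on the admissible channels: `a0_k ≥ 0 → s_k ≥ 0` (feeds `D`). -/
private theorem popovCoeff_nonneg (k : (Fin 10 × Fin 10) ⊕ (Fin 10 × Fin 10)) (hk : 0 ≤ a0 k) :
    0 ≤ dualPopovCoeff NE39.splitLurieLinesSystem Z₂₁ Z₂₂ k := by
  rw [(functionals_eq k).2.2.2]
  have hk' : 0 ≤ a0Kᵣ₂ k := by unfold a0 at hk; exact_mod_cast hk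
  exact_mod_cast (dual_testsᵣ₂ k).2.1 hk'

/-- **(D4a)** `a0 < b0` (feeds `D`). -/
private theorem slope_lt (k : (Fin 10 × Fin 10) ⊕ (Fin 10 × Fin 10)) : a0 k < b0 k := by
  unfold a0 b0; exact_mod_cast (dual_testsᵣ₂ k).2.2.1

/-- **(D4b)** `tr Z₁₁ > 0` (feeds `D`). -/
private theorem trace_pos : 0 < Matrix.trace Z₁₁ := by
  have h : Matrix.trace Z₁₁ = ((Matrix.trace Z11Qᵣ₂ : ℚ) : ℝ) := by
    simp [Z₁₁, Matrix.trace, Rat.cast_sum]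
  rw [h]; exact_mod_cast trace_testᵣ₂

/-- **THE CLASS-OF-RECORD DUAL WITNESS** against the slab/Popov certificate class `SlabCertificate` on `S = NE39.splitLurieLinesSystem` at the
window-extreme slopes `(a0, b0)` of the window `γ₀ = 2·arctan(23/1600)` — rank 19, Gram-factored.
[cite: BoydVandenberghe2004, §5.9.4 (5.97)–(5.98), Example 5.14; Khalil2002, §7.1 Example 7.5] -/
def D : SlabDualWitness NE39.splitLurieLinesSystem a0 b0 where
  Z₁₁ := Z₁₁
  Z₂₁ := Z₂₁
  Z₂₂ := Z₂₂
  psd := psd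
  adjP_psd := adjP_psd
  sectorCoeff_nonneg := sectorCoeff_nonneg
  popovCoeff_nonneg := popovCoeff_nonneg
  slope_lt := slope_lt
  trace_pos := trace_pos

/-- The diagonal channels (both families) are NULL for the witness (four vanishing functionals). -/
private theorem isNull_diag (k : (Fin 10 × Fin 10) ⊕ (Fin 10 × Fin 10)) (hk : (pairOfᵣ₂ k).1 = (pairOfᵣ₂ k).2) : D.IsNull k := by
  obtain ⟨hU, hV, hW, hS⟩ := functionals_eq k
  obtain ⟨h1, h2, h3, h4⟩ := (dual_testsᵣ₂ k).2.2.2 hk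
  refine ⟨?_, ?_, ?_, ?_⟩
  · show (NE39.splitLurieLinesSystem.C * Z₁₁ * NE39.splitLurieLinesSystem.Cᵀ) k k = 0; rw [hU]; exact_mod_cast h1
  · show (Z₂₁ * NE39.splitLurieLinesSystem.Cᵀ) k k = 0; rw [hV]; exact_mod_cast h2
  · show Z₂₂ k k = 0; rw [hW]; exact_mod_cast h3
  · show dualPopovCoeff NE39.splitLurieLinesSystem Z₂₁ Z₂₂ k = 0; rw [hS]; exact_mod_cast h4

/-! ### The window points of the 180 channels `p ≠ q` (exact cosines; `ξ = 0` on the wide sine channels) -/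

/-- The two window end points `δ ± γ` and their cosines from `(cos δ, sin δ) = (cδ, sδ)`, `(cos γ, sin γ) = (c, s)`. -/
private theorem window_points {δ γ cδ sδ c s : ℝ} (hc : Real.cos δ = cδ) (hs : Real.sin δ = sδ)
    (hcg : Real.cos γ = c) (hsg : Real.sin γ = s) (hγ : 0 ≤ γ) :
    (∃ ξ, |ξ - δ| ≤ γ ∧ Real.cos ξ = cδ * c - sδ * s) ∧ (∃ ξ, |ξ - δ| ≤ γ ∧ Real.cos ξ = cδ * c + sδ * s) :=
  ⟨⟨δ + γ, by simp [abs_of_nonneg hγ], by rw [Real.cos_add, hc, hs, hcg, hsg]⟩,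
    ⟨δ - γ, by simp [abs_of_nonneg hγ], by rw [Real.cos_sub, hc, hs, hcg, hsg]⟩⟩

/-- The centre `ξ = 0` lies in the window `|ξ − δ| ≤ γ` as soon as `cos γ ≤ cos δ` (`|δ| < π/2`, `0 ≤ γ < π/2`), and
`cos 0 = 1`. -/
private theorem center_point {δ γ cδ c : ℝ} (hδ : |δ| < π / 2) (hγ0 : 0 ≤ γ) (_hγ : γ < π / 2)
    (hc : Real.cos δ = cδ) (hcg : Real.cos γ = c) (hle : c ≤ cδ) :
    ∃ ξ, |ξ - δ| ≤ γ ∧ Real.cos ξ = 1 := by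
  refine ⟨0, ?_, Real.cos_zero⟩
  rw [zero_sub, abs_neg]
  by_contra hlt
  push Not at hlt
  have h1 : Real.cos |δ| < Real.cos γ :=
    Real.cos_lt_cos_of_nonneg_of_le_pi hγ0 (by linarith [abs_nonneg δ, Real.pi_pos]) hlt
  rw [Real.cos_abs, hc, hcg] at h1
  linarith

/-- **`hwin`**: every channel is NULL or has window points `ξa`, `ξb` in `|ξ − δ*_k| ≤ γ₀` with `cos ξa ≤ a0_k`,
`b0_k ≤ cos ξb`. -/
private theorem hwin : ∀ k, D.IsNull k ∨
    ((∃ ξ, |ξ - NE39.splitLurieLinesSystem.δs k| ≤ γ₀ ∧ Real.cos ξ ≤ a0 k) ∧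
      ∃ ξ, |ξ - NE39.splitLurieLinesSystem.δs k| ≤ γ₀ ∧ b0 k ≤ Real.cos ξ) := by
  rintro (⟨p, q⟩ | ⟨p, q⟩)
  · by_cases hpq : p = q
    · exact Or.inl (isNull_diag _ hpq)
    right
    have hδs : NE39.splitLurieLinesSystem.δs (Sum.inl (p, q)) = NE39.preLossless.angleOf p - NE39.preLossless.angleOf q := rfl
    obtain ⟨⟨ξ₁, hξ₁, hc₁⟩, ξ₂, hξ₂, hc₂⟩ := window_points (NE39.cos_angleOf_sub p q)
      (NE39.sin_angleOf_sub p q) cos_γ₀_cast sin_γ₀_cast γ₀_range.1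
    obtain ⟨hlo, hhi⟩ := window_tests_sinᵣ₂ p q hpq
    rw [hδs]
    refine ⟨?_, ?_⟩
    · rcases hlo with h | h
      · exact ⟨ξ₁, hξ₁, by rw [hc₁, a0]; exact_mod_cast h⟩
      · exact ⟨ξ₂, hξ₂, by rw [hc₂, a0]; exact_mod_cast h⟩
    · rcases hhi with (h | h) | ⟨hw, hb⟩
      · exact ⟨ξ₁, hξ₁, by rw [hc₁, b0]; exact_mod_cast h⟩
      · exact ⟨ξ₂, hξ₂, by rw [hc₂, b0]; exact_mod_cast h⟩
      · obtain ⟨ξ₀, hξ₀, hc₀⟩ := center_point (NE39.abs_angle_sub_lt p q) γ₀_range.1 γ₀_range.2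
          (NE39.cos_angleOf_sub p q) cos_γ₀_cast (by exact_mod_cast hw)
        exact ⟨ξ₀, hξ₀, by rw [hc₀, b0]; exact_mod_cast hb⟩
  · by_cases hpq : p = q
    · exact Or.inl (isNull_diag _ hpq)
    right
    have hδs : NE39.splitLurieLinesSystem.δs (Sum.inr (p, q)) = NE39.preLossless.angleOf p - NE39.preLossless.angleOf q + π / 2 := rfl
    have hc : Real.cos (NE39.preLossless.angleOf p - NE39.preLossless.angleOf q + π / 2) = -((NE39.preLossless.sd p q : ℚ) : ℝ) := by
      rw [Real.cos_add_pi_div_two, NE39.sin_angleOf_sub]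
    have hs : Real.sin (NE39.preLossless.angleOf p - NE39.preLossless.angleOf q + π / 2) = ((NE39.preLossless.cd p q : ℚ) : ℝ) := by
      rw [Real.sin_add_pi_div_two, NE39.cos_angleOf_sub]
    obtain ⟨⟨ξ₁, hξ₁, hc₁⟩, ξ₂, hξ₂, hc₂⟩ := window_points hc hs cos_γ₀_cast sin_γ₀_cast γ₀_range.1
    obtain ⟨hlo, hhi⟩ := window_tests_cosᵣ₂ p q hpq
    rw [hδs]
    refine ⟨?_, ?_⟩
    · rcases hlo with h | h
      · exact ⟨ξ₁, hξ₁, by rw [hc₁, a0]; exact_mod_cast h⟩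
      · exact ⟨ξ₂, hξ₂, by rw [hc₂, a0]; exact_mod_cast h⟩
    · rcases hhi with h | h
      · exact ⟨ξ₁, hξ₁, by rw [hc₁, b0]; exact_mod_cast h⟩
      · exact ⟨ξ₂, hξ₂, by rw [hc₂, b0]; exact_mod_cast h⟩

/-! ### THE THEOREMS -/

/-- **No certificate of the CLASS OF RECORD (`SlabCertificate S`: `P ⪰ ε·1`, Popov terms only where `a ≥ 0`) on the split
presentation of the lossy 39-bus model at the window `2·arctan(23/1600)` (= `γ₀`, `γ₀_eq`).**
[cite: BoydVandenberghe2004, §5.9.4 (5.97)–(5.98), Example 5.14; Khalil2002, §7.1 Example 7.5] -/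
private theorem no_splitSlabCertificate_γ₀ (Λ : SlabCertificate NE39.splitLurieLinesSystem)
    (hsec : ∀ k ξ, |ξ - NE39.splitLurieLinesSystem.δs k| ≤ γ₀ → Λ.a k ≤ Real.cos ξ ∧ Real.cos ξ ≤ Λ.b k) :
    False :=
  Λ.false_of_dualWitness_of_exists_window D (γ := fun _ => γ₀) hsec hwin

/-- **No certificate of the CLASS OF RECORD on the split presentation of the lossy 39-bus model at the window `2·arctan(23/1600)`**
(≈ 1.647°). [cite: BoydVandenberghe2004, §5.9.4 (5.97)–(5.98), Example 5.14; Khalil2002, §7.1 Example 7.5] -/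
theorem no_splitSlabCertificate_at₂ (Λ : SlabCertificate NE39.splitLurieLinesSystem)
    (hsec : ∀ k ξ, |ξ - NE39.splitLurieLinesSystem.δs k| ≤ 2 * Real.arctan (23 / 1600 : ℝ) → Λ.a k ≤ Real.cos ξ ∧ Real.cos ξ ≤ Λ.b k) :
    False :=
  no_splitSlabCertificate_γ₀ Λ fun k ξ hξ => hsec k ξ (hξ.trans γ₀_eq.le)

/-- **Per-channel windows**: the refutation needs the window only on the 180 channels `p ≠ q` and only `γ_k ≥ γ₀` there. -/
theorem no_splitSlabCertificate_perChannel (Λ : SlabCertificate NE39.splitLurieLinesSystem) (γ : (Fin 10 × Fin 10) ⊕ (Fin 10 × Fin 10) → ℝ)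
    (hγ : ∀ k, (pairOfᵣ₂ k).1 ≠ (pairOfᵣ₂ k).2 → γ₀ ≤ γ k)
    (hsec : ∀ k ξ, |ξ - NE39.splitLurieLinesSystem.δs k| ≤ γ k → Λ.a k ≤ Real.cos ξ ∧ Real.cos ξ ≤ Λ.b k) :
    False := by
  refine Λ.false_of_dualWitness_of_exists_window D (γ := γ) hsec fun k => ?_
  by_cases hk : (pairOfᵣ₂ k).1 = (pairOfᵣ₂ k).2
  · exact Or.inl (isNull_diag k hk)
  · rcases hwin k with h | ⟨⟨ξa, hξa, hca⟩, ξb, hξb, hcb⟩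
    · exact Or.inl h
    · exact Or.inr ⟨⟨ξa, hξa.trans (hγ k hk), hca⟩, ξb, hξb.trans (hγ k hk), hcb⟩

/-- **The CLASS OF RECORD is EMPTY at every window `≥ 2·arctan(23/1600)`** (≈ 1.647°; this file's rank-19 Gram-factored dual witness). -/
theorem recordClass_empty_from_NE39 :
    ∀ γ' : ℝ, 2 * Real.arctan (23 / 1600 : ℝ) ≤ γ' → ¬ ∃ Λ : SlabCertificate NE39.splitLurieLinesSystem,
      ∀ k ξ, |ξ - NE39.splitLurieLinesSystem.δs k| ≤ γ' → Λ.a k ≤ Real.cos ξ ∧ Real.cos ξ ≤ Λ.b k :=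
  fun _ hγ' ⟨Λ, hsec⟩ => no_splitSlabCertificate_at₂ Λ fun k ξ hξ => hsec k ξ (hξ.trans hγ')

/-- The tightened record bracket is consistent and proper: `2·arctan(7/500) < 2·arctan(23/1600) < 2·arctan(3/200)`. -/
theorem recordBracket_ends_lt :
    2 * Real.arctan (7 / 500 : ℝ) < 2 * Real.arctan (23 / 1600 : ℝ) ∧ 2 * Real.arctan (23 / 1600 : ℝ) < 2 * Real.arctan (3 / 200 : ℝ) := by
  have h1 : (7 / 500 : ℝ) < 23 / 1600 := by norm_num
  have h2 : (23 / 1600 : ℝ) < 3 / 200 := by norm_num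
  have := Real.arctan_strictMono h1
  have := Real.arctan_strictMono h2
  constructor <;> linarith

/-- **THE TWO SPLIT BRACKETS ON THE LOSSY 39-BUS OBJECT, TIGHTENED ON THE RECORD SIDE**: the class of record is NON-EMPTY at
`2·arctan(7/500)` (`NE39LossySplitLinesU7o500SlabCert`, exact Schur-form certificate) and EMPTY at every window `≥ 2·arctan(23/1600)`
(≈ 1.647°, this file); the positivity class is NON-EMPTY at `2·arctan(3/200)` (`NE39LossySplitLinesU3o200LPCert`) and EMPTY at every
window `≥ 2·arctan(13/800)` (`NE39LossySplitLinesLPDual`).  Read as TYPED: the supremum of record-certifiable windows lies in the CLOSED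
bracket [2·arctan(7/500), 2·arctan(23/1600)] ≈ [1.604°, 1.647°], that of the positivity class in [1.719°, 1.862°]; nothing is said
about windows strictly inside a bracket, and nothing here is a region-of-attraction statement. -/
theorem splitBrackets_tighter_NE39 :
    (∃ Λ : SlabCertificate NE39.splitLurieLinesSystem,
      ∀ k ξ, |ξ - NE39.splitLurieLinesSystem.δs k| ≤ 2 * Real.arctan (7 / 500 : ℝ) → Λ.a k ≤ Real.cos ξ ∧ Real.cos ξ ≤ Λ.b k) ∧
    (∀ γ' : ℝ, 2 * Real.arctan (23 / 1600 : ℝ) ≤ γ' → ¬ ∃ Λ : SlabCertificate NE39.splitLurieLinesSystem,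
      ∀ k ξ, |ξ - NE39.splitLurieLinesSystem.δs k| ≤ γ' → Λ.a k ≤ Real.cos ξ ∧ Real.cos ξ ≤ Λ.b k) ∧
    (∃ Λ : LPSlabCertificate NE39.splitLurieLinesSystem,
      ∀ k ξ, |ξ - NE39.splitLurieLinesSystem.δs k| ≤ 2 * Real.arctan (3 / 200 : ℝ) → Λ.a k ≤ Real.cos ξ ∧ Real.cos ξ ≤ Λ.b k) ∧
    (∀ γ' : ℝ, 2 * Real.arctan (13 / 800 : ℝ) ≤ γ' → ¬ ∃ Λ : LPSlabCertificate NE39.splitLurieLinesSystem,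
      ∀ k ξ, |ξ - NE39.splitLurieLinesSystem.δs k| ≤ γ' → Λ.a k ≤ Real.cos ξ ∧ Real.cos ξ ≤ Λ.b k) :=
  ⟨NE39LossySplitLinesU7o500SlabCert.slabSplitClass_nonempty_NE39, recordClass_empty_from_NE39,
    NE39LossySplitLinesU3o200LPCert.lpSplitClass_nonempty_NE39,
    fun γ' hγ' => NE39LossySplitLinesLPDual.lpSplitClass_empty_NE39 γ' (NE39LossySplitLinesLPDual.γ₀_eq ▸ hγ')⟩

end Summit.Ventures.GridStability.Lyapunov.NE39LossySplitLinesU23o1600RecDual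

end
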